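import Summits.RiemannHypothesis.RiemannHypothesis.Theorems.LiCoefficientsDefs
import Literature.NumberTheory.LFunctions.KeiperLiPositivityUpTo
import Literature.NumberTheory.LFunctions.KeiperLiTrend
import Literature.NumberTheory.LFunctions.LiCoefficientArithmeticFormula
import Literature.NumberTheory.LFunctions.Equivalents
import Literature.NumberTheory.DiophantineGeometry.NamedHypotheses
import HarnessLib

/-!
# RiemannHypothesis / LI column — vocabulary PART C and the rung leaf L-P(P1⁺):
# the Li ASYMPTOTIC LAW in the quadratic range (RH-FREE)

Cell `pub/rh-li` (D-0040/D-0059/D-0061), theory memo `theory/TARGETS.md` §11 (gen 5).  Statement-only module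
(`def`s + `@[conjecture]` targets + PROVED glue corollaries; no `sorry`, no axioms), the successor of PART A/B in
`Theorems/LiCoefficientsDefs.lean`.

THE LAW.  Keiper (1992, Fig. 1) observed and Lagarias (Ann. Inst. Fourier 57 (2007) Thm 1.1, p.4 remark) proved
UNDER RH that `λ_n = (n/2) log n + C₁ n + O(√n log n)`, `C₁ = (γ − 1 − log 2π)/2 = liC1 = −1.1303…`; Lagarias remarks
(p.4) that RH verified to height `T` gives the same for `n ≤ T²/(4 log² T)` «with the implied O-constant depending on
π» — no explicit constant, no clean range and no RH-free formulation is in print.  The rung leaf below is the EFFECTIVE, RH-FREE version in the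
quadratic range `n ≤ T²/4`:

* `LiAsymptoticLawQuadratic` (LEAF L-P(P1⁺)): if every zero of `ζ` with `0 < Im ρ ≤ T` (`T ≥ 1000`) lies on the
  critical line then `|λ_n − (n/2) log n − C₁ n| ≤ 2 √n log n` for `900 ≤ n ≤ T²/4` and `≤ (1/3) √n log n` for
  `3·10⁵ ≤ n ≤ T²/4`.  RH-FREE: a finite verified height, finitely many `λ_n`; the zeros above `T` are controlled
  unconditionally (far pairs `O(n²/|ρ|⁴ + n/|ρ|³)`, Backlund's explicit `S(t)`, Turing's `∫S` bound); nothing here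
  bears on the truth of RH.  It STRENGTHENS the rung L-P(P1) `LiHeightLawQuadratic` (`λ_n ≥ 0`, `n ≤ T²/5`) to a
  two-sided law with the true main term.
* corollaries (PROVED from the leaf): `liAsymptoticPlattTrudgian_of` (the band for `3·10⁵ ≤ n ≤ 2.25·10²⁴` at the
  Platt–Trudgian height), `liPrimePartBound_of` (Keiper's arithmetic/oscillatory part
  `λ_n − λ̄_n = Σ_{j<n} C(n,j+1) Re η_j` is `O(√n log n)` in the same range, via the tree's `keiperLiTrend_log_bounds`).

FENCE (RH-EQUIVALENT, not a target here): the same band for ALL `n ≥ n₀` with no height restriction is equivalent to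
RH (⇐ Lagarias 2007 Thm 1.1; ⇒ Bombieri–Lagarias 1999 Thm 1 with Li's criterion, since an off-line zero makes `λ_n`
unbounded below).  The leaf never leaves the verified range `n ≤ T²/4` (Voros 2018: sensitivity to RH only for
`n ≳ T²`), so it is PROOF-OF-DATA, never distance-to-summit.

MECHANISM (route `Theses/LiAsymptotic.lean`, cruxes over the vocabulary below): `λ_n = lim_{T'} Re Σ_{liZeroBox T'}`
(`keiperLiCoeff_eq_zero_sum_holds`); two-sided far-pair comparison `|pair − 2 m f_n(γ)| ≤ m(2.82 n²/γ⁴ + n/(2γ³))`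
(crux LiBoxTwoSided) summed by the RH-free tails `Σ_{γ>T} m/γ⁴ ≤ log T/(6πT³)` (tree `liFarZeroTail_bound`) and
`Σ_{γ>T} m/γ³ ≤ log T/(4πT²)` (LiFarZeroTailCube); zeros below `√n` counted trivially (`0 ≤ f_n ≤ 2`,
LiLowZerosTrivial); above `√n` the window identity `Σ m f_n = (1/π)∫ f_n ϑ' + [S f_n] − ∫ S f_n'`
(tree `Window.windowIdentity`) with the smooth main term `(2/π)∫_{√n}^{∞} f_n ϑ' = (n/2) log n + C₁ n − 2 N₀(√n) + O(log n)`
(crux LiSmoothMainTerm; the constant comes from `∫₀^∞ (1 − cos u) log u du/u² = (π/2)(1 − γ)`) and the `S`-terms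
bounded by Backlund (`|S| ≤ 0.3083 log t + 3.24`) resp. Turing (`|∫S| ≤ 2.30 + 0.128 log(t/2π)`, one more
integration by parts) (crux LiOscillatoryS); an explicit budget (crux LiAsymptoticBudget) closes the constants.
-/

noncomputable section

-- D-0017: `Summit.<S>.<S>.…` is the designed namespace of a single-problem summit.
set_option linter.dupNamespace false

namespace Summit.RiemannHypothesis.RiemannHypothesis.Theorems.LiTheory

open Literature.NumberTheory.LFunctions Literature.NumberTheory.LFunctions.SchoenfeldBound
open Literature.NumberTheory.DiophantineGeometry

/-! ## PART C — vocabulary of the asymptotic law -/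

/-- The Keiper–Lagarias MAIN TERM `(n/2) log n + C₁ n`, `C₁ = liC1 = (γ − 1 − log 2π)/2 = −1.1303…`
(Lagarias 2007 (1.11); Keiper 1992 Fig. 1). -/
def liMainTerm (n : ℕ) : ℝ :=
  (n : ℝ) / 2 * Real.log n + liC1 * n

/-- The Riemann–von Mangoldt main term `N₀(a) = (a/2π) log(a/(2πe))` of the zero-counting function (same
expression as in `ZetaArgBacklund.abs_zetaZeroCount_sub_main_le_explicit`). -/
def liCountMain (a : ℝ) : ℝ :=
  a / (2 * Real.pi) * Real.log (a / (2 * Real.pi * Real.exp 1))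

/-- FAR-ZERO error `E_far(n,T) = 2.82 n² · log T/(6πT³) + (n/2) · log T/(4πT²)`: the two-sided far-pair
comparison summed by the RH-free tails `Σ_{γ>T} m/γ⁴ ≤ log T/(6πT³)`, `Σ_{γ>T} m/γ³ ≤ log T/(4πT²)`. -/
def liErrFar (n : ℕ) (T : ℝ) : ℝ :=
  2.82 * (n : ℝ) ^ 2 * (Real.log T / (6 * Real.pi * T ^ 3)) + (n : ℝ) / 2 * (Real.log T / (4 * Real.pi * T ^ 2))

/-- LOW-ZERO error `E_low(n) = 2 N₀(√n) + 4 (0.3083 log √n + 4.128)`: the zeros with `0 < γ ≤ √n` counted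
trivially (`0 ≤ 2 Σ m f_n ≤ 4 N(√n)`), centred at `2 N₀(√n)`. -/
def liErrLow (n : ℕ) : ℝ :=
  2 * liCountMain (Real.sqrt n) + 4 * (0.3083 * Real.log (Real.sqrt n) + 4.128)

/-- SMOOTH error `E_smooth(n) = 2 log n + 1`: `|(2/π)∫_{√n}^{T'} f_n ϑ' − (liMainTerm n − 2 N₀(√n))|` for `T' ≥ n²`
(`|ϑ' − ½ log(t/2π)| ≤ 2/t`, `0 ≤ 1/t − θ(t) ≤ 1/(12t³)`, one integration by parts at both cuts). -/
def liErrSmooth (n : ℕ) : ℝ :=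
  2 * Real.log n + 1

/-- OSCILLATORY (`S`-term) error, TURING form (`√n > 168π`):
`E_S(n) = 0.043 √n log n + 1.41 √n + 0.75 log n + 17.3` (Backlund boundary terms + Turing's `∫S` bound after a
second integration by parts, `|f_n''| ≤ n²/t⁴ + 2n/t³`). -/
def liErrOsc (n : ℕ) : ℝ :=
  0.043 * Real.sqrt n * Real.log n + 1.41 * Real.sqrt n + 0.75 * Real.log n + 17.3

/-- OSCILLATORY (`S`-term) error, PLAIN form (`√n ≥ 30`): `E_S⁰(n) = 0.3083 √n log n + 7.1 √n + 0.62 log n + 13`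
(`|S| ≤ 0.3083 log t + 3.24` against `|f_n'| ≤ n/t²`, no Turing input). -/
def liErrOscPlain (n : ℕ) : ℝ :=
  0.3083 * Real.sqrt n * Real.log n + 7.1 * Real.sqrt n + 0.62 * Real.log n + 13

/-! ## The rung LEAF L-P(P1⁺) and its corollaries -/

/-- **LEAF L-P(P1⁺) (RH-FREE; new in print as an explicit statement): the Li ASYMPTOTIC LAW, quadratic range** —
if every zero of `ζ` with `0 < Im ρ ≤ T` (`T ≥ 1000`) lies on the critical line, then for every `n ≤ T²/4`:
`|λ_n − (n/2) log n − C₁ n| ≤ 2 √n log n` when `n ≥ 900` (plain Backlund form) and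
`|λ_n − (n/2) log n − C₁ n| ≤ (1/3) √n log n` when `n ≥ 3·10⁵` (Turing form, `√n > 168π`).  A FINITE verified
height, finitely many coefficients; the zeros above `T` are controlled unconditionally.  In print: the
`O(√n log n)` shape under RH (Lagarias 2007 Thm 1.1) and the remark that a verified height gives
`n ≤ T²/(4 log² T)` with an unspecified constant (ibid. p.4); Keiper 1992 Fig. 1 (numerics, `n ≤ 7000`).
Budget margins (theory memo §11, kit j246961): sup of (error budget)/(C √n log n) = 0.818 (plain, at n = 900) and
0.792 (Turing, at n = 3·10⁵).  Route `Theses/LiAsymptotic.lean`. [folklore] -/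
@[conjecture] def LiAsymptoticLawQuadratic : Prop :=
  ∀ ⦃T : ℝ⦄, 1000 ≤ T → RiemannHypothesisUpTo T → ∀ ⦃n : ℕ⦄, (n : ℝ) ≤ 1 / 4 * T ^ 2 →
    (900 ≤ n → |keiperLiCoeff n - liMainTerm n| ≤ 2 * Real.sqrt n * Real.log n) ∧
    (300000 ≤ n → |keiperLiCoeff n - liMainTerm n| ≤ 1 / 3 * Real.sqrt n * Real.log n)

/-- **COROLLARY at the Platt–Trudgian height** (`riemannHypothesisUpTo_platt_trudgian`, `T = 3 000 175 332 800`,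
`T²/4 = 2.2502…·10²⁴`): `|λ_n − (n/2) log n − C₁ n| ≤ (1/3) √n log n` for every `3·10⁵ ≤ n ≤ 2.25·10²⁴`
(and `≤ 2 √n log n` for `900 ≤ n ≤ 2.25·10²⁴`).  RH-FREE. [folklore] -/
@[conjecture] def LiAsymptoticPlattTrudgian : Prop :=
  riemannHypothesisUpTo_platt_trudgian → ∀ ⦃n : ℕ⦄, n ≤ 2250000000000000000000000 →
    (900 ≤ n → |keiperLiCoeff n - liMainTerm n| ≤ 2 * Real.sqrt n * Real.log n) ∧
    (300000 ≤ n → |keiperLiCoeff n - liMainTerm n| ≤ 1 / 3 * Real.sqrt n * Real.log n)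

/-- Glue (PROVED): the leaf gives the Platt–Trudgian corollary. -/
theorem liAsymptoticPlattTrudgian_of (h : LiAsymptoticLawQuadratic) : LiAsymptoticPlattTrudgian := by
  intro hPT n hn'
  refine h (T := 3000175332800) (by norm_num) hPT ?_
  have h' : (n : ℝ) ≤ 2250000000000000000000000 := by exact_mod_cast hn'
  refine h'.trans ?_
  norm_num

/-- **COROLLARY (Keiper's oscillatory / prime part is `O(√n log n)` in the verified range; RH-FREE)**: for RH up
to `T ≥ 1000` and `3·10⁵ ≤ n ≤ T²/4`, `|Σ_{j<n} C(n,j+1) Re η_j| ≤ (1/3) √n log n + 1 + 2/π`, where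
`Σ_{j<n} C(n,j+1) Re η_j = λ_n − (trend)` is the arithmetic part of the Bombieri–Lagarias/Coffey formula
(`η_j = Xiao2020.zetaOneLogDerivCoeff j`; the trend is `(n/2) log n + C₁ n + O(1)` by `keiperLiTrend_log_bounds`).
[folklore] -/
@[conjecture] def LiPrimePartBound : Prop :=
  ∀ ⦃T : ℝ⦄, 1000 ≤ T → RiemannHypothesisUpTo T → ∀ ⦃n : ℕ⦄, 300000 ≤ n → (n : ℝ) ≤ 1 / 4 * T ^ 2 →
    |∑ j ∈ Finset.range n, (n.choose (j + 1) : ℝ) * (Xiao2020.zetaOneLogDerivCoeff j).re|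
      ≤ 1 / 3 * Real.sqrt n * Real.log n + 1 + 2 / Real.pi

/-- Glue (PROVED): the leaf and the tree's trend bounds give the prime-part corollary. -/
theorem liPrimePartBound_of (h : LiAsymptoticLawQuadratic) : LiPrimePartBound := by
  intro T hT hRH n hn hnc
  have hn1 : 1 ≤ n := le_trans (by norm_num) hn
  have hlaw := abs_le.1 ((h hT hRH hnc).2 hn)
  obtain ⟨hlo, hhi⟩ := keiperLiTrend_log_bounds hn1
  have hmain : (n : ℝ) / 2 * (Real.log n + Real.eulerMascheroniConstant - 1 - Real.log (2 * Real.pi)) =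
      liMainTerm n := by
    simp only [liMainTerm, liC1]; ring
  rw [hmain] at hlo hhi
  rw [abs_le]
  constructor <;> linarith

/-- Sanity glue (PROVED): inside the Turing range the law forces `λ_n > 0` as soon as the main term beats the band
(it does for every `n ≥ 3·10⁵`: at `n = 3·10⁵` the main term is `1.55·10⁶` against a band of `2.3·10³`; the
numerical comparison `hband` is left to the user). -/
theorem keiperLiCoeff_pos_of_liAsymptoticLawQuadratic (h : LiAsymptoticLawQuadratic) {T : ℝ} (hT : 1000 ≤ T)
    (hRH : RiemannHypothesisUpTo T) {n : ℕ} (hn : 300000 ≤ n) (hnc : (n : ℝ) ≤ 1 / 4 * T ^ 2)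
    (hband : 1 / 3 * Real.sqrt n * Real.log n < liMainTerm n) : 0 < keiperLiCoeff n := by
  have := abs_le.1 ((h hT hRH hnc).2 hn)
  linarith [this.1]

end Summit.RiemannHypothesis.RiemannHypothesis.Theorems.LiTheory

end
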